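import Literature.Probability.RandomPlanarGeometry.SAWLoopErasureMemoryTwoPenultimate
import HarnessLib

/-!
# Memory-2 walks with a forbidden first step — Hara–Slade–Sokal (3.12) at coefficient level

In the taboo recursion of Hara, Slade and Sokal [HSS93, §3.2 eq. (3.10)–(3.13) p. 17–18] for the memory-2
two-point function `C^{A∪{b}}₂(y,x;β)`, the walk is cut at its first visit to `b`; the piece after `b` is a
memory-2 walk `ω₂ : b → x` avoiding `A` whose FIRST step must not return to the site `b + f` it came from, and
"repeated inclusion-exclusion to remove the constraint that `ω₂(1) ≠ b+f`" gives, as printed,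

* (3.12) `Σ_{ω₂: b→x, ω₂∩A=∅} β^{|ω₂|} I[ω₂(1) ≠ b+f]
     = C^A₂(b,x;β) − β·C^A₂(b+f,x;β) + β²·C^A₂(b,x;β) − β³·C^A₂(b+f,x;β) + …
     = (1/(1−β²))·[C^A₂(b,x;β) − β·C^A₂(b+f,x;β)]`.

This module proves the COEFFICIENT-LEVEL content of (3.12), translated so that walks start at the origin (the
tree's `nbwAvoidTo A x n` of `SAWLoopErasureMemoryTwoPenultimate`: the `n`-step non-backtracking walks `0 → x`
avoiding `A`).  With `tabooShift A f = A − e_f` (the obstacle seen from `e_f`) and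
`N_n = #nbwAvoidToFirst A x f n` (the walks of `nbwAvoidTo A x n` whose first step is not `f`):

* the first-step bijection `#nbwAvoidTo A x (n+1) = N_{n+1}(A,x,f) + N_n(A − e_f, x − e_f, −f)`
  (`card_nbwAvoidTo_succ_eq_add`: a walk with first step `f` is `f` followed by a translated walk from the origin
  whose first step is not `−f`), for `0 ∉ A`;
* hence, for `0 ∉ A` and `e_f ∉ A`, the two-step recurrence `N_{n+2} + c_{n+1}(A − e_f, x − e_f) = c_{n+2}(A, x) + N_n`
  (`card_nbwAvoidToFirst_add_two_add`, with `c_n(A,x) = #nbwAvoidTo A x n`) — the alternating series of (3.12);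
* for the truncated generating functions the exact identity `N_{K+2}(β) + β·C'_{K+1}(β) = C_{K+2}(β) + β²·N_K(β)`
  (`sum_nbwAvoidToFirst_add_two_eq`; (3.12) multiplied by `1 − β²` and truncated), the inequality
  `(1 − β²)·N_{K+2}(β) ≤ C_{K+2}(β) − β·C'_{K+1}(β)` and the two-sided sandwich
  `C_{K+2}(β) − β·C'_{K+1}(β) ≤ N_{K+2}(β) + β²·…` in the form needed to evaluate (3.13) with interval inputs.

Here `C_K(β) = Σ_{n≤K} c_n(A,x) βⁿ` and `C'_K(β) = Σ_{n≤K} c_n(A − e_f, x − e_f) βⁿ` (the coefficients of `C^A₂(0,x;β)`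
and of the translate of `C^A₂(e_f,x;β)`).
-/

noncomputable section

namespace Literature.Probability.RandomPlanarGeometry.SAW.Zd.LoopErasure

open Finset
open scoped BigOperators
open Literature.Probability.LatticeModels Literature.Probability.LatticeModels.SRW
open Literature.Barriers.CriticalPhenomena.SAWLace (pos_cons_succ)
open Literature.Probability.Percolation (IsNBW srev srev_srev)

variable {d : ℕ}

/-! ### Prepending a step: plumbing -/

/-- `(a·ω)_{i+1} = ω_i`. [cite: MadrasSlade1993, §1.2 (p. 10) (step words; lane plumbing)] -/
theorem stepSeq_cons_apply_succ {n : ℕ} (a : Dir d) (ω : StepSeq d n) {i : ℕ} (hi : i < n) (h : i + 1 < n + 1) :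
    (Fin.cons a ω : StepSeq d (n + 1)) ⟨i + 1, h⟩ = ω ⟨i, hi⟩ := by
  have e : (⟨i + 1, h⟩ : Fin (n + 1)) = Fin.succ ⟨i, hi⟩ := rfl
  rw [e, Fin.cons_succ]

/-- `(a·ω)_0 = a`. [cite: MadrasSlade1993, §1.2 (p. 10) (step words; lane plumbing)] -/
theorem stepSeq_cons_apply_zero {n : ℕ} (a : Dir d) (ω : StepSeq d n) (h : 0 < n + 1) :
    (Fin.cons a ω : StepSeq d (n + 1)) ⟨0, h⟩ = a := rfl

/-- `a·ω` is non-backtracking iff `ω` is and the first step of `ω` does not reverse `a` (no condition for `n = 0`).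
[cite: MadrasSlade1993, §1.2 (memory 2 rules out immediate reversals; lane plumbing)] -/
theorem isNBW_cons_iff {n : ℕ} (a : Dir d) (ω : StepSeq d n) :
    IsNBW (Fin.cons a ω : StepSeq d (n + 1)) ↔ IsNBW ω ∧ ∀ i : Fin n, (i : ℕ) = 0 → ω i ≠ srev a := by
  constructor
  · intro h
    refine ⟨fun k hk => ?_, fun i hi => ?_⟩
    · have h1 := h (k + 1) (by omega)
      rwa [stepSeq_cons_apply_succ a ω hk, stepSeq_cons_apply_succ a ω (show k < n by omega)] at h1
    · have h1 := h 0 (by omega)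
      rw [stepSeq_cons_apply_succ a ω (show 0 < n by omega), stepSeq_cons_apply_zero] at h1
      have e : i = ⟨0, by omega⟩ := Fin.ext hi
      rw [e]
      exact h1
  · rintro ⟨h, ha⟩ k hk
    rcases Nat.eq_zero_or_pos k with hk0 | hkp
    · subst hk0
      rw [stepSeq_cons_apply_succ a ω (show 0 < n by omega), stepSeq_cons_apply_zero]
      exact ha ⟨0, by omega⟩ rfl
    · obtain ⟨j, rfl⟩ : ∃ j, k = j + 1 := ⟨k - 1, by omega⟩
      rw [stepSeq_cons_apply_succ a ω (show j + 1 < n by omega), stepSeq_cons_apply_succ a ω (show j < n by omega)]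
      exact h j (by omega)

/-! ### The obstacle seen from a neighbour -/

/-- `A − e_f`: the obstacle set translated so that the neighbour `e_f` becomes the origin.
[cite: HaraSladeSokal1993, §3.2 eq. (3.11)–(3.12) p. 18 (the walks from b+f; lane plumbing)] -/
def tabooShift (A : Finset (Site d)) (f : Dir d) : Finset (Site d) :=
  A.image fun a => a - stepVec f

/-- Membership in `tabooShift`. [cite: HaraSladeSokal1993, §3.2 eq. (3.11)–(3.12) p. 18 (lane plumbing)] -/
theorem mem_tabooShift {A : Finset (Site d)} {f : Dir d} {y : Site d} :
    y ∈ tabooShift A f ↔ y + stepVec f ∈ A := by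
  classical
  rw [tabooShift, Finset.mem_image]
  constructor
  · rintro ⟨a, ha, rfl⟩
    rwa [sub_add_cancel]
  · intro h
    exact ⟨y + stepVec f, h, add_sub_cancel_right _ _⟩

/-- `(A − e_f) − e_{−f} = A`. [cite: HaraSladeSokal1993, §3.2 eq. (3.11)–(3.12) p. 18 (lane plumbing)] -/
theorem tabooShift_tabooShift_srev (A : Finset (Site d)) (f : Dir d) : tabooShift (tabooShift A f) (srev f) = A := by
  ext y
  rw [mem_tabooShift, mem_tabooShift, stepVec_srev, neg_add_cancel_right]

/-- `0 ∈ A − e_f ↔ e_f ∈ A`. [cite: HaraSladeSokal1993, §3.2 eq. (3.11)–(3.12) p. 18 (lane plumbing)] -/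
theorem zero_mem_tabooShift_iff {A : Finset (Site d)} {f : Dir d} : (0 : Site d) ∈ tabooShift A f ↔ stepVec f ∈ A := by
  rw [mem_tabooShift, zero_add]

/-! ### Walks whose first step is not `f` -/

open Classical in
/-- The walks of `nbwAvoidTo A x n` whose first step is not `f` (no condition for `n = 0`): the coefficients of the
left side of (3.12), translated to start at the origin. [cite: HaraSladeSokal1993, §3.2 eq. (3.12) p. 18 (Σ β^{|ω₂|} I[ω₂(1) ≠ b+f])] -/
def nbwAvoidToFirst (A : Finset (Site d)) (x : Site d) (f : Dir d) (n : ℕ) : Finset (StepSeq d n) :=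
  (nbwAvoidTo A x n).filter fun ω => ∀ i : Fin n, (i : ℕ) = 0 → ω i ≠ f

/-- Membership in `nbwAvoidToFirst`. [cite: HaraSladeSokal1993, §3.2 eq. (3.12) p. 18 (lane plumbing)] -/
theorem mem_nbwAvoidToFirst {A : Finset (Site d)} {x : Site d} {f : Dir d} {n : ℕ} {ω : StepSeq d n} :
    ω ∈ nbwAvoidToFirst A x f n ↔
      ((IsNBW ω ∧ ∀ t ≤ n, pos ω t ∉ A) ∧ endpoint ω = x) ∧ ∀ i : Fin n, (i : ℕ) = 0 → ω i ≠ f := by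
  classical
  rw [nbwAvoidToFirst, Finset.mem_filter, mem_nbwAvoidTo]

/-- The walks of `nbwAvoidTo A x (n+1)` whose first step IS `f` are `f` followed by a translated walk
`0 → x − e_f` avoiding `A − e_f` whose first step is not `−f` (for `0 ∉ A`).
[cite: HaraSladeSokal1993, §3.2 eq. (3.11)–(3.12) p. 18 (cutting after the first step)] -/
theorem filter_nbwAvoidTo_first_eq_image {A : Finset (Site d)} (h0 : (0 : Site d) ∉ A) (x : Site d) (f : Dir d)
    (n : ℕ) :
    ((nbwAvoidTo A x (n + 1)).filter fun ω => ¬ ∀ i : Fin (n + 1), (i : ℕ) = 0 → ω i ≠ f) =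
      (nbwAvoidToFirst (tabooShift A f) (x - stepVec f) (srev f) n).image
        fun ζ => (Fin.cons f ζ : StepSeq d (n + 1)) := by
  classical
  ext ω
  rw [Finset.mem_filter, Finset.mem_image, mem_nbwAvoidTo]
  constructor
  · rintro ⟨⟨⟨hnbw, havoid⟩, hend⟩, hfirst⟩
    push Not at hfirst
    obtain ⟨i, hi, hif⟩ := hfirst
    have e0 : ω 0 = f := by
      have : i = 0 := Fin.ext hi
      rw [← this, hif]
    have hω : (Fin.cons f (Fin.tail ω) : StepSeq d (n + 1)) = ω := by rw [← e0, Fin.cons_self_tail]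
    refine ⟨Fin.tail ω, ?_, hω⟩
    have hnbw' := (isNBW_cons_iff f (Fin.tail ω)).1 (by rw [hω]; exact hnbw)
    rw [mem_nbwAvoidToFirst]
    refine ⟨⟨⟨hnbw'.1, fun t ht hA => ?_⟩, ?_⟩, hnbw'.2⟩
    · rw [mem_tabooShift, add_comm, ← pos_cons_succ f (Fin.tail ω) t, hω] at hA
      exact havoid (t + 1) (by omega) hA
    · have h1 := endpoint_cons f (Fin.tail ω)
      rw [hω, hend] at h1
      rw [h1, add_sub_cancel_left]
  · rintro ⟨ζ, hζ, rfl⟩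
    rw [mem_nbwAvoidToFirst] at hζ
    obtain ⟨⟨⟨hnbw, havoid⟩, hend⟩, hfirst⟩ := hζ
    refine ⟨⟨⟨(isNBW_cons_iff f ζ).2 ⟨hnbw, hfirst⟩, fun t ht => ?_⟩, ?_⟩, ?_⟩
    · rcases Nat.eq_zero_or_eq_succ_pred t with ht0 | ht1
      · rw [ht0, pos_zero]
        exact h0
      · rw [ht1, pos_cons_succ]
        intro hA
        refine havoid t.pred (by omega) ?_
        rw [mem_tabooShift, add_comm]
        exact hA
    · rw [endpoint_cons, hend, add_sub_cancel]
    · push Not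
      exact ⟨⟨0, by omega⟩, rfl, rfl⟩

/-- **The first-step bijection, counted**: `#nbwAvoidTo A x (n+1) = N_{n+1}(A,x,f) + N_n(A − e_f, x − e_f, −f)`
for `0 ∉ A`. [cite: HaraSladeSokal1993, §3.2 eq. (3.12) p. 18 (one inclusion–exclusion step)] -/
theorem card_nbwAvoidTo_succ_eq_add {A : Finset (Site d)} (h0 : (0 : Site d) ∉ A) (x : Site d) (f : Dir d) (n : ℕ) :
    (nbwAvoidTo A x (n + 1)).card =
      (nbwAvoidToFirst A x f (n + 1)).card + (nbwAvoidToFirst (tabooShift A f) (x - stepVec f) (srev f) n).card := by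
  classical
  have hinj : Function.Injective fun ζ : StepSeq d n => (Fin.cons f ζ : StepSeq d (n + 1)) :=
    fun ζ ζ' h => (Fin.cons_injective2.eq_iff.1 h).2
  rw [← Finset.card_image_of_injective _ hinj, ← filter_nbwAvoidTo_first_eq_image h0 x f n, nbwAvoidToFirst]
  exact (Finset.card_filter_add_card_filter_not _).symm

/-- **(3.12) as a two-step recurrence**: `N_{n+2}(A,x,f) + c_{n+1}(A − e_f, x − e_f) = c_{n+2}(A,x) + N_n(A,x,f)` for
`0 ∉ A`, `e_f ∉ A` (`c_n(A,x) = #nbwAvoidTo A x n`): the alternating series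
`C^A₂(b,x) − βC^A₂(b+f,x) + β²C^A₂(b,x) − …` term by term. [cite: HaraSladeSokal1993, §3.2 eq. (3.12) p. 18] -/
theorem card_nbwAvoidToFirst_add_two_add {A : Finset (Site d)} (h0 : (0 : Site d) ∉ A) {f : Dir d}
    (hf : stepVec f ∉ A) (x : Site d) (n : ℕ) :
    (nbwAvoidToFirst A x f (n + 2)).card + (nbwAvoidTo (tabooShift A f) (x - stepVec f) (n + 1)).card =
      (nbwAvoidTo A x (n + 2)).card + (nbwAvoidToFirst A x f n).card := by
  have h1 : (nbwAvoidTo A x (n + 2)).card = (nbwAvoidToFirst A x f (n + 2)).card +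
      (nbwAvoidToFirst (tabooShift A f) (x - stepVec f) (srev f) (n + 1)).card :=
    card_nbwAvoidTo_succ_eq_add h0 x f (n + 1)
  have h0' : (0 : Site d) ∉ tabooShift A f := fun h => hf (zero_mem_tabooShift_iff.1 h)
  have h2 := card_nbwAvoidTo_succ_eq_add h0' (x - stepVec f) (srev f) n
  rw [tabooShift_tabooShift_srev, stepVec_srev, sub_neg_eq_add, sub_add_cancel, srev_srev] at h2
  omega

/-! ### Initial values -/

/-- At length `0` there is no first step: `N₀ = c₀`. [cite: HaraSladeSokal1993, §3.2 eq. (3.12) p. 18 (lane plumbing: initial values)] -/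
theorem card_nbwAvoidToFirst_zero (A : Finset (Site d)) (x : Site d) (f : Dir d) :
    (nbwAvoidToFirst A x f 0).card = (nbwAvoidTo A x 0).card := by
  classical
  rw [nbwAvoidToFirst]
  congr 1
  exact Finset.filter_true_of_mem fun ω _ i => i.elim0

/-- `N₁ + c₀(A − e_f, x − e_f) = c₁(A, x)` (the first-step bijection at length `1`). [cite: HaraSladeSokal1993, §3.2 eq. (3.12) p. 18 (lane plumbing: initial values)] -/
theorem card_nbwAvoidToFirst_one_add {A : Finset (Site d)} (h0 : (0 : Site d) ∉ A) (x : Site d) (f : Dir d) :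
    (nbwAvoidToFirst A x f 1).card + (nbwAvoidTo (tabooShift A f) (x - stepVec f) 0).card =
      (nbwAvoidTo A x 1).card := by
  rw [card_nbwAvoidTo_succ_eq_add h0 x f 0, card_nbwAvoidToFirst_zero]

/-! ### (3.12), multiplied out: truncated generating functions -/

/-- **(3.12) at every truncation order**: with `N_K(β) = Σ_{n≤K} N_n βⁿ`, `C_K(β) = Σ_{n≤K} c_n(A,x) βⁿ`,
`C'_K(β) = Σ_{n≤K} c_n(A − e_f, x − e_f) βⁿ`: `N_{K+2}(β) + β·C'_{K+1}(β) = C_{K+2}(β) + β²·N_K(β)` exactly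
(`(1 − β²)·Σ β^{|ω₂|} I[ω₂(1) ≠ b+f] = C^A₂(b,x;β) − β·C^A₂(b+f,x;β)` in the limit).
[cite: HaraSladeSokal1993, §3.2 eq. (3.12) p. 18] -/
theorem sum_nbwAvoidToFirst_add_two_eq {A : Finset (Site d)} (h0 : (0 : Site d) ∉ A) {f : Dir d}
    (hf : stepVec f ∉ A) (x : Site d) (β : ℝ) (K : ℕ) :
    ∑ n ∈ range (K + 3), ((nbwAvoidToFirst A x f n).card : ℝ) * β ^ n +
        β * ∑ n ∈ range (K + 2), ((nbwAvoidTo (tabooShift A f) (x - stepVec f) n).card : ℝ) * β ^ n =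
      ∑ n ∈ range (K + 3), ((nbwAvoidTo A x n).card : ℝ) * β ^ n +
        β ^ 2 * ∑ n ∈ range (K + 1), ((nbwAvoidToFirst A x f n).card : ℝ) * β ^ n := by
  induction K with
  | zero =>
    have e0 : ((nbwAvoidToFirst A x f 0).card : ℝ) = (nbwAvoidTo A x 0).card := by
      exact_mod_cast card_nbwAvoidToFirst_zero A x f
    have e1 : ((nbwAvoidToFirst A x f 1).card : ℝ) + (nbwAvoidTo (tabooShift A f) (x - stepVec f) 0).card =
        (nbwAvoidTo A x 1).card := by exact_mod_cast card_nbwAvoidToFirst_one_add h0 x f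
    have h' : ((nbwAvoidToFirst A x f 2).card : ℝ) + (nbwAvoidTo (tabooShift A f) (x - stepVec f) 1).card =
        (nbwAvoidTo A x 2).card + (nbwAvoidToFirst A x f 0).card := by
      exact_mod_cast card_nbwAvoidToFirst_add_two_add h0 hf x 0
    simp only [Finset.sum_range_succ, Finset.sum_range_zero, zero_add, pow_zero, mul_one, pow_one]
    linear_combination e0 + β * e1 + β ^ 2 * h'
  | succ K ih =>
    have h' : ((nbwAvoidToFirst A x f (K + 3)).card : ℝ) + (nbwAvoidTo (tabooShift A f) (x - stepVec f) (K + 2)).card =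
        (nbwAvoidTo A x (K + 3)).card + (nbwAvoidToFirst A x f (K + 1)).card := by
      exact_mod_cast card_nbwAvoidToFirst_add_two_add h0 hf x (K + 1)
    rw [show K + 1 + 3 = (K + 3) + 1 from rfl, show K + 1 + 2 = (K + 2) + 1 from rfl,
      Finset.sum_range_succ (fun n => ((nbwAvoidToFirst A x f n).card : ℝ) * β ^ n) (K + 3),
      Finset.sum_range_succ (fun n => ((nbwAvoidTo (tabooShift A f) (x - stepVec f) n).card : ℝ) * β ^ n) (K + 2),
      Finset.sum_range_succ (fun n => ((nbwAvoidTo A x n).card : ℝ) * β ^ n) (K + 3),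
      Finset.sum_range_succ (fun n => ((nbwAvoidToFirst A x f n).card : ℝ) * β ^ n) (K + 1)]
    linear_combination ih + β ^ (K + 3) * h'

/-- The truncated first-step sums are monotone in the truncation. [cite: HaraSladeSokal1993, §3.2 eq. (3.12) p. 18 (lane plumbing)] -/
theorem sum_nbwAvoidToFirst_mono (A : Finset (Site d)) (x : Site d) (f : Dir d) {β : ℝ} (hβ : 0 ≤ β) {K K' : ℕ}
    (h : K ≤ K') :
    ∑ n ∈ range (K + 1), ((nbwAvoidToFirst A x f n).card : ℝ) * β ^ n ≤
      ∑ n ∈ range (K' + 1), ((nbwAvoidToFirst A x f n).card : ℝ) * β ^ n :=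
  Finset.sum_le_sum_of_subset_of_nonneg (Finset.range_subset_range.2 (by omega))
    fun n _ _ => mul_nonneg (Nat.cast_nonneg _) (pow_nonneg hβ n)

/-- **(3.12) as an upper inequality at every truncation**: `(1 − β²)·N_{K+2}(β) ≤ C_{K+2}(β) − β·C'_{K+1}(β)` for
`β ≥ 0`. [cite: HaraSladeSokal1993, §3.2 eq. (3.12) p. 18] -/
theorem one_sub_sq_mul_sum_nbwAvoidToFirst_le {A : Finset (Site d)} (h0 : (0 : Site d) ∉ A) {f : Dir d}
    (hf : stepVec f ∉ A) (x : Site d) {β : ℝ} (hβ : 0 ≤ β) (K : ℕ) :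
    (1 - β ^ 2) * ∑ n ∈ range (K + 3), ((nbwAvoidToFirst A x f n).card : ℝ) * β ^ n ≤
      ∑ n ∈ range (K + 3), ((nbwAvoidTo A x n).card : ℝ) * β ^ n -
        β * ∑ n ∈ range (K + 2), ((nbwAvoidTo (tabooShift A f) (x - stepVec f) n).card : ℝ) * β ^ n := by
  have h := sum_nbwAvoidToFirst_add_two_eq h0 hf x β K
  have hm := mul_le_mul_of_nonneg_left (sum_nbwAvoidToFirst_mono A x f hβ (show K ≤ K + 2 by omega)) (sq_nonneg β)
  linarith

/-- **… and as a lower inequality**: `C_{K+2}(β) − β·C'_{K+1}(β) ≤ N_{K+2}(β)` for `0 ≤ β` (drop `β²·N_K ≥ 0`… with the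
sign of (3.12): `N_{K+2} = C_{K+2} − β C'_{K+1} + β² N_K ≥ C_{K+2} − β C'_{K+1}`). [cite: HaraSladeSokal1993, §3.2 eq. (3.12) p. 18] -/
theorem sum_nbwAvoidTo_sub_le_sum_nbwAvoidToFirst {A : Finset (Site d)} (h0 : (0 : Site d) ∉ A) {f : Dir d}
    (hf : stepVec f ∉ A) (x : Site d) {β : ℝ} (hβ : 0 ≤ β) (K : ℕ) :
    ∑ n ∈ range (K + 3), ((nbwAvoidTo A x n).card : ℝ) * β ^ n -
        β * ∑ n ∈ range (K + 2), ((nbwAvoidTo (tabooShift A f) (x - stepVec f) n).card : ℝ) * β ^ n ≤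
      ∑ n ∈ range (K + 3), ((nbwAvoidToFirst A x f n).card : ℝ) * β ^ n := by
  have h := sum_nbwAvoidToFirst_add_two_eq h0 hf x β K
  have hN : 0 ≤ ∑ n ∈ range (K + 1), ((nbwAvoidToFirst A x f n).card : ℝ) * β ^ n :=
    Finset.sum_nonneg fun n _ => mul_nonneg (Nat.cast_nonneg _) (pow_nonneg hβ n)
  nlinarith [sq_nonneg β]

end Literature.Probability.RandomPlanarGeometry.SAW.Zd.LoopErasure

end
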